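import Literature.NumberTheory.Rogawski1990.AdelicStableConjugacyG2
import Literature.NumberTheory.Rogawski1990.AdelicStableOrbitalSupportFiniteHolds
import Literature.NumberTheory.Rogawski1990.RegularEltLocalisation
import HarnessLib

/-!
# The two-form adelic stable class `𝒪_st(γ₀ ∕ 𝐀) ⊂ U(H₂)(𝐀)` over a REGULAR rational `γ₀ ∈ U(H₁)(L⁺)` meets a compact set in finitely many `U(H₂)(𝐀)`-classes;
# `Σ_{𝒞_𝐀} Φ(δ, f)` and its `κ`-twists are finitely supported — hypothesis-free (Rogawski 1990, §3.3 p. 21, §4.3 p. 44, §5.4 pp. 72–73; Kottwitz 1986, Prop. 7.1)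

Topic `NumberTheory/Rogawski1990`; namespace `Literature.NumberTheory.Rogawski1990`; THEOREMS ONLY (no definition, no instance, no named fact, no `sorry`).  Cell
`pub/hodgecm-mathlib`, ENGINE T1 (crux H413 = `stmt-HodgeConjecture-24833`), row O11: the FOURTH twin of ★ `AdelicStableOrbitalSupportFinite` (`G = U(Φ₃)` over
`MatchingAdeleG`), ★ `…H`, ★ `…Gp` (`G′` over `γ_H`), now for the two-form carrier ★ `MatchingAdeleG₂ L H₁ H₂ γ₀` of ★ `AdelicStableConjugacyG2` — in particular the
SELF carrier `𝒞′_𝐀(γ₀) = MatchingAdeleG₂.classes L H H γ₀` over which the pre-stabilisation ★ `PreStabilisationCount` is read (its hypothesis `hfin`), INCLUDING the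
stable classes of type (3) that are not transfers from `H` (no `γ_H`, so ★ `…Gp` does not reach them).

WHAT IS TYPED (`H₂` non-degenerate hermitian, `γ₀` REGULAR; no rational point of `U(H₂)` in the class is needed):
* §1 `MatchingAdeleG₂.charpoly_eq_of_corresponds_toLocal` — a local correspondent of `(γ₀)_v` has characteristic polynomial `charpoly γ₀ ⊗ 1`; hence [Kt₄] Prop. 7.1 in the
  RELATIVE `K_v`-form **`MatchingAdeleG₂.eventually_forall_exists_conj`**: for almost all `v`, two elements of `K₂,v = U(H₂)(𝒪_v)` corresponding to `(γ₀)_v` are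
  `K₂,v`-conjugate — PROVED (★ `UnitaryGroup.eventually_forall_integralConj_cmDatum_of_charpoly_eq` at `p := charpoly γ₀`, separable by regularity);
* §2 **`MatchingAdeleG₂.finite_setOf_mem_classes_inter`** — for `C ⊂ U(H₂)(𝐀)` compact, `{c ∈ 𝒞_𝐀(γ₀) | c ∩ C ≠ ∅}` is finite (integrality of `C` off a finite `S` ★
  `UnitaryGroup.exists_finset_forall_toLocal_mem_of_isCompact`; local ∕ archimedean finiteness ★ `finite_image_conjClassesMk_inter_corresponds_local ∕ _archCM` at the regular base
  points `(γ₀)_v`, `γ₀ ⊗ 1` (★ `isRegularElt_toLocal_toAdelic`, ★ `isRegularElt_cmRationalToArch`); gluing ★ `UnitaryGroup.isConj_of_isConj_archPart_of_forall_exists_conj`);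
* §3 **`MatchingAdeleG₂.finite_classes_inter_support_classOrbitalIntegral`** (EVERY orbital family `m`, EVERY `f` with compact support), the weighted twin
  `…_support_mul_…` (the `κ`-twisted summands of ★ `adelicKappaOrbitalSum`), the `C_c` form; §4 the SELF-carrier readings `…_self` (`H₂ = H₁`).
HC_CM is proved only modulo the printed citations until rung 0 closes; this file is unconditional.

## References
* [Rogawski1990] J. D. Rogawski, *Automorphic Representations of Unitary Groups in Three Variables*, Ann. of Math. Stud. 123 (1990), §3.3 p. 21, §4.3 p. 44, §5.4 pp. 72–73.
* [Kottwitz1986] R. E. Kottwitz, *Stable trace formula: elliptic singular terms*, Math. Ann. 275 (1986), Prop. 7.1, Cor. 7.3.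
* [BorelJacquet1979] A. Borel, H. Jacquet, *Automorphic forms and automorphic representations*, PSPM 33.1 (1979), §4.1.
-/

set_option autoImplicit false

noncomputable section

open NumberField IsDedekindDomain Filter Topology
open scoped Matrix MatrixGroups Polynomial

namespace Literature.NumberTheory.Rogawski1990

open Literature.NumberTheory.Automorphic
open Literature.AlgebraicGeometry.ShimuraVarieties (unitaryGroup)

section FiniteG2

variable {L : Type} [Field L] [NumberField L] [IsCMField L] {H₁ H₂ : Matrix (Fin 3) (Fin 3) L} {γ₀ : (UnitaryGroup.cmDatum L 3 H₁).Rational}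

/-! ## §1 Characteristic polynomials of local correspondents; [Kt₄] Prop. 7.1 in the relative `K_v`-form, PROVED -/

/-- A local correspondent `g ∈ U(H₂)(L⁺_v)` of `(γ₀)_v` has characteristic polynomial `charpoly γ₀ ⊗ 1` (★ `Corresponds.charpoly_eq`, ★ `coe_cmDatum_toLocal_toAdelic`,
`Matrix.charpoly_map`). [cite: Rogawski1990, §3.3 p. 21; §14.1 p. 232] -/
theorem MatchingAdeleG₂.charpoly_eq_of_corresponds_toLocal (v : HeightOneSpectrum (𝓞 ↥(maximalRealSubfield L))) (g : (UnitaryGroup.cmDatum L 3 H₂).Local v)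
    (h : Corresponds (UnitaryGroup.conjLocal L (IsCMField.complexConj L) v) ((UnitaryGroup.adelicForm L 3 H₁).map (UnitaryGroup.adeleToLocal L v))
      ((UnitaryGroup.adelicForm L 3 H₂).map (UnitaryGroup.adeleToLocal L v)) ((UnitaryGroup.cmDatum L 3 H₁).toLocal v ((UnitaryGroup.cmDatum L 3 H₁).toAdelic γ₀)) g) :
    (((g.val : GL (Fin 3) (UnitaryGroup.LocalRing L v))) : Matrix (Fin 3) (Fin 3) (UnitaryGroup.LocalRing L v)).charpoly =
      ((((γ₀.val : GL (Fin 3) L)) : Matrix (Fin 3) (Fin 3) L).charpoly).map (algebraMap L (UnitaryGroup.LocalRing L v)) := by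
  rw [← h.charpoly_eq, UnitaryGroup.coe_cmDatum_toLocal_toAdelic, UnitaryGroup.coe_toLocalGL_apply, Matrix.charpoly_map]

/-- **[Kt₄] Prop. 7.1 for `U(H₂)` over a REGULAR `γ₀ ∈ U(H₁)(L⁺)`, relative `K_v`-form, PROVED**: for almost every finite place `v` of `L⁺`, any two `g, g′ ∈ K₂,v = U(H₂)(𝒪_v)`
corresponding to `(γ₀)_v` are conjugate by an element of `K₂,v` — both have characteristic polynomial `charpoly γ₀ ⊗ 1`, separable by regularity; ★
`UnitaryGroup.eventually_forall_integralConj_cmDatum_of_charpoly_eq` (a.e. set depending on `(H₂, charpoly γ₀)` only). [cite: Kottwitz1986, Prop. 7.1; Cor. 7.3]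
[cite: Rogawski1990, §3.3 p. 21] -/
theorem MatchingAdeleG₂.eventually_forall_exists_conj (hH : (H₂.map (cmConjRingHom L))ᵀ = H₂) (hdet : H₂.det ≠ 0) (hreg : IsRegularElt (γ₀.val : GL (Fin 3) L)) :
    ∀ᶠ v in cofinite, ∀ g g' : (UnitaryGroup.cmDatum L 3 H₂).Local v,
      g ∈ UnitaryGroup.cmLocalIntegralLevel L 3 H₂ v → g' ∈ UnitaryGroup.cmLocalIntegralLevel L 3 H₂ v →
        Corresponds (UnitaryGroup.conjLocal L (IsCMField.complexConj L) v) ((UnitaryGroup.adelicForm L 3 H₁).map (UnitaryGroup.adeleToLocal L v))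
          ((UnitaryGroup.adelicForm L 3 H₂).map (UnitaryGroup.adeleToLocal L v)) ((UnitaryGroup.cmDatum L 3 H₁).toLocal v ((UnitaryGroup.cmDatum L 3 H₁).toAdelic γ₀)) g →
        Corresponds (UnitaryGroup.conjLocal L (IsCMField.complexConj L) v) ((UnitaryGroup.adelicForm L 3 H₁).map (UnitaryGroup.adeleToLocal L v))
          ((UnitaryGroup.adelicForm L 3 H₂).map (UnitaryGroup.adeleToLocal L v)) ((UnitaryGroup.cmDatum L 3 H₁).toLocal v ((UnitaryGroup.cmDatum L 3 H₁).toAdelic γ₀)) g' →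
          ∃ k ∈ UnitaryGroup.cmLocalIntegralLevel L 3 H₂ v, k * g * k⁻¹ = g' := by
  filter_upwards [UnitaryGroup.eventually_forall_integralConj_cmDatum_of_charpoly_eq L 3 H₂ hH hdet _ hreg] with v hv g g' hg hg' hc hc'
  exact hv g g' hg hg' (MatchingAdeleG₂.charpoly_eq_of_corresponds_toLocal v g hc) (MatchingAdeleG₂.charpoly_eq_of_corresponds_toLocal v g' hc')

/-! ## §2 Only finitely many classes of `𝒞_𝐀(γ₀) ⊂ ConjClasses U(H₂)(𝐀)` meet a compact set -/

/-- **Only finitely many `U(H₂)(𝐀)`-classes of the adelic stable class over a regular `γ₀` meet a compact set** (`H₂` non-degenerate hermitian): for `C ⊂ U(H₂)(𝐀)` compact,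
`{c ∈ 𝒞_𝐀(γ₀) | c ∩ C ≠ ∅}` is finite.  PROOF as in the three ★ twins: `C` is integral off a finite `S` (★ `UnitaryGroup.exists_finset_forall_toLocal_mem_of_isCompact`); off
`S ∪ S_bad` two corresponding components in `C` are `K₂,v`-conjugate (§1); at the remaining places and at `∞` finitely many classes corresponding to the regular `(γ₀)_v` ∕
`γ₀ ⊗ 1` meet the compact image (★ `finite_image_conjClassesMk_inter_corresponds_local` ∕ `…_archCM`); a `U(H₂)(𝐀)`-class is determined by these data (gluing ★
`UnitaryGroup.isConj_of_isConj_archPart_of_forall_exists_conj`). [cite: Rogawski1990, §3.3 p. 21; §4.3 p. 44; §5.4 p. 72] [cite: Kottwitz1986, Prop. 7.1] -/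
theorem MatchingAdeleG₂.finite_setOf_mem_classes_inter (hH : (H₂.map (cmConjRingHom L))ᵀ = H₂) (hdet : H₂.det ≠ 0) (hreg : IsRegularElt (γ₀.val : GL (Fin 3) L))
    {C : Set (UnitaryGroup.cmDatum L 3 H₂).Adelic} (hC : IsCompact C) :
    {c : ConjClasses (UnitaryGroup.cmDatum L 3 H₂).Adelic | c ∈ MatchingAdeleG₂.classes L H₁ H₂ γ₀ ∧ ∃ g ∈ C, ConjClasses.mk g = c}.Finite := by
  classical
  -- (1) `C` is integral off a finite set `S`
  obtain ⟨S, hS⟩ := UnitaryGroup.exists_finset_forall_toLocal_mem_of_isCompact (↥(maximalRealSubfield L)) L (IsCMField.complexConj L) 3 H₂ hC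
  -- (2) the bad places of [Kt₄] 7.1
  have hP := MatchingAdeleG₂.eventually_forall_exists_conj (γ₀ := γ₀) hH hdet hreg
  have hTfin := Filter.eventually_cofinite.1 hP
  set T : Finset (HeightOneSpectrum (𝓞 ↥(maximalRealSubfield L))) := S ∪ hTfin.toFinset with hTdef
  have hTS : ∀ v ∉ T, v ∉ S := fun v hv h => hv (Finset.mem_union_left _ h)
  have hTP : ∀ v ∉ T, ∀ g g' : (UnitaryGroup.cmDatum L 3 H₂).Local v,
      g ∈ UnitaryGroup.cmLocalIntegralLevel L 3 H₂ v → g' ∈ UnitaryGroup.cmLocalIntegralLevel L 3 H₂ v →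
        Corresponds (UnitaryGroup.conjLocal L (IsCMField.complexConj L) v) ((UnitaryGroup.adelicForm L 3 H₁).map (UnitaryGroup.adeleToLocal L v))
          ((UnitaryGroup.adelicForm L 3 H₂).map (UnitaryGroup.adeleToLocal L v)) ((UnitaryGroup.cmDatum L 3 H₁).toLocal v ((UnitaryGroup.cmDatum L 3 H₁).toAdelic γ₀)) g →
        Corresponds (UnitaryGroup.conjLocal L (IsCMField.complexConj L) v) ((UnitaryGroup.adelicForm L 3 H₁).map (UnitaryGroup.adeleToLocal L v))
          ((UnitaryGroup.adelicForm L 3 H₂).map (UnitaryGroup.adeleToLocal L v)) ((UnitaryGroup.cmDatum L 3 H₁).toLocal v ((UnitaryGroup.cmDatum L 3 H₁).toAdelic γ₀)) g' →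
          ∃ k ∈ UnitaryGroup.cmLocalIntegralLevel L 3 H₂ v, k * g * k⁻¹ = g' := by
    intro v hv
    by_contra hnot
    exact hv (Finset.mem_union_right _ (hTfin.mem_toFinset.2 hnot))
  -- (3) representatives IN `C`
  let rep : ConjClasses (UnitaryGroup.cmDatum L 3 H₂).Adelic → (UnitaryGroup.cmDatum L 3 H₂).Adelic := fun c =>
    if h : ∃ g ∈ C, ConjClasses.mk g = c then h.choose else Quotient.out c
  have hrep : ∀ c, (∃ g ∈ C, ConjClasses.mk g = c) → rep c ∈ C ∧ ConjClasses.mk (rep c) = c := by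
    intro c h
    simp only [rep, dif_pos h]
    exact h.choose_spec
  have hmatch : ∀ c, c ∈ MatchingAdeleG₂.classes L H₁ H₂ γ₀ → (∃ g ∈ C, ConjClasses.mk g = c) → ∃ p : MatchingAdeleG₂ L H₁ H₂ γ₀, p.adele = rep c :=
    fun c hc h => MatchingAdeleG₂.exists_adele_eq_of_mem_classes hc (hrep c h).2
  -- (4) finitely many local classes at each place, and at `∞`, meet the image of `C`
  have hAv : ∀ v : HeightOneSpectrum (𝓞 ↥(maximalRealSubfield L)),
      (ConjClasses.mk '' {x : (UnitaryGroup.cmDatum L 3 H₂).Local v |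
        x ∈ (UnitaryGroup.cmDatum L 3 H₂).toLocal v '' C ∧
          Corresponds (UnitaryGroup.conjLocal L (IsCMField.complexConj L) v) ((UnitaryGroup.adelicForm L 3 H₁).map (UnitaryGroup.adeleToLocal L v))
            ((UnitaryGroup.adelicForm L 3 H₂).map (UnitaryGroup.adeleToLocal L v)) ((UnitaryGroup.cmDatum L 3 H₁).toLocal v ((UnitaryGroup.cmDatum L 3 H₁).toAdelic γ₀)) x}).Finite :=
    fun v => UnitaryGroup.finite_image_conjClassesMk_inter_corresponds_local L 3 H₂ H₁ v hH hdet _ (isRegularElt_toLocal_toAdelic L H₁ γ₀ hreg v)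
      (hC.image ((UnitaryGroup.cmDatum L 3 H₂).continuous_toLocal v))
  have hAi : (ConjClasses.mk '' {x : UnitaryGroup.arch (↥(maximalRealSubfield L)) L (IsCMField.complexConj L) 3 H₂ |
      x ∈ UnitaryGroup.archPart (↥(maximalRealSubfield L)) L (IsCMField.complexConj L) 3 H₂ '' C ∧
        Corresponds (UnitaryGroup.conjMixed (↥(maximalRealSubfield L)) L (IsCMField.complexConj L)) (UnitaryGroup.archFormOf L 3 H₁) (UnitaryGroup.archFormOf L 3 H₂)
          (cmRationalToArch L 3 H₁ γ₀) x}).Finite :=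
    UnitaryGroup.finite_image_conjClassesMk_inter_corresponds_archCM L 3 H₂ H₁ hH hdet _ (isRegularElt_cmRationalToArch L H₁ γ₀ hreg)
      (hC.image (UnitaryGroup.continuous_archPart (↥(maximalRealSubfield L)) L (IsCMField.complexConj L) 3 H₂))
  -- (5) the map «class ↦ (local classes at T, archimedean class)», with finite target on our set
  let Ψ : ConjClasses (UnitaryGroup.cmDatum L 3 H₂).Adelic →
      ((v : ↥T) → ConjClasses ((UnitaryGroup.cmDatum L 3 H₂).Local v.1)) × ConjClasses (UnitaryGroup.arch (↥(maximalRealSubfield L)) L (IsCMField.complexConj L) 3 H₂) := fun c =>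
    (fun v => ConjClasses.mk ((UnitaryGroup.cmDatum L 3 H₂).toLocal v.1 (rep c)), ConjClasses.mk (UnitaryGroup.archPart (↥(maximalRealSubfield L)) L (IsCMField.complexConj L) 3 H₂ (rep c)))
  have hfinTarget : (Set.pi Set.univ (fun v : ↥T => ConjClasses.mk '' {x : (UnitaryGroup.cmDatum L 3 H₂).Local v.1 |
        x ∈ (UnitaryGroup.cmDatum L 3 H₂).toLocal v.1 '' C ∧
          Corresponds (UnitaryGroup.conjLocal L (IsCMField.complexConj L) v.1) ((UnitaryGroup.adelicForm L 3 H₁).map (UnitaryGroup.adeleToLocal L v.1))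
            ((UnitaryGroup.adelicForm L 3 H₂).map (UnitaryGroup.adeleToLocal L v.1)) ((UnitaryGroup.cmDatum L 3 H₁).toLocal v.1 ((UnitaryGroup.cmDatum L 3 H₁).toAdelic γ₀)) x}) ×ˢ
      (ConjClasses.mk '' {x : UnitaryGroup.arch (↥(maximalRealSubfield L)) L (IsCMField.complexConj L) 3 H₂ |
        x ∈ UnitaryGroup.archPart (↥(maximalRealSubfield L)) L (IsCMField.complexConj L) 3 H₂ '' C ∧
          Corresponds (UnitaryGroup.conjMixed (↥(maximalRealSubfield L)) L (IsCMField.complexConj L)) (UnitaryGroup.archFormOf L 3 H₁) (UnitaryGroup.archFormOf L 3 H₂)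
            (cmRationalToArch L 3 H₁ γ₀) x})).Finite :=
    (Set.Finite.pi fun v => hAv v.1).prod hAi
  have hmaps : Set.MapsTo Ψ {c | c ∈ MatchingAdeleG₂.classes L H₁ H₂ γ₀ ∧ ∃ g ∈ C, ConjClasses.mk g = c}
      (Set.pi Set.univ (fun v : ↥T => ConjClasses.mk '' {x : (UnitaryGroup.cmDatum L 3 H₂).Local v.1 |
        x ∈ (UnitaryGroup.cmDatum L 3 H₂).toLocal v.1 '' C ∧
          Corresponds (UnitaryGroup.conjLocal L (IsCMField.complexConj L) v.1) ((UnitaryGroup.adelicForm L 3 H₁).map (UnitaryGroup.adeleToLocal L v.1))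
            ((UnitaryGroup.adelicForm L 3 H₂).map (UnitaryGroup.adeleToLocal L v.1)) ((UnitaryGroup.cmDatum L 3 H₁).toLocal v.1 ((UnitaryGroup.cmDatum L 3 H₁).toAdelic γ₀)) x}) ×ˢ
      (ConjClasses.mk '' {x : UnitaryGroup.arch (↥(maximalRealSubfield L)) L (IsCMField.complexConj L) 3 H₂ |
        x ∈ UnitaryGroup.archPart (↥(maximalRealSubfield L)) L (IsCMField.complexConj L) 3 H₂ '' C ∧
          Corresponds (UnitaryGroup.conjMixed (↥(maximalRealSubfield L)) L (IsCMField.complexConj L)) (UnitaryGroup.archFormOf L 3 H₁) (UnitaryGroup.archFormOf L 3 H₂)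
            (cmRationalToArch L 3 H₁ γ₀) x})) := by
    rintro c ⟨hc, hgC⟩
    obtain ⟨p, hp⟩ := hmatch c hc hgC
    have hrc := (hrep c hgC).1
    refine Set.mk_mem_prod (Set.mem_univ_pi.2 fun v => ?_) ?_
    · refine ⟨(UnitaryGroup.cmDatum L 3 H₂).toLocal v.1 (rep c), ⟨⟨rep c, hrc, rfl⟩, ?_⟩, rfl⟩
      have h2 := p.corresponds_toLocal v.1
      rw [hp] at h2
      exact h2
    · refine ⟨UnitaryGroup.archPart (↥(maximalRealSubfield L)) L (IsCMField.complexConj L) 3 H₂ (rep c), ⟨⟨rep c, hrc, rfl⟩, ?_⟩, rfl⟩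
      have h2 := p.corresponds_arch
      rw [MatchingAdeleG₂.arch, hp] at h2
      exact h2
  -- (6) injectivity on our set: the GLUING LEMMA (relative integral conjugators off `T`)
  have hinj : Set.InjOn Ψ {c | c ∈ MatchingAdeleG₂.classes L H₁ H₂ γ₀ ∧ ∃ g ∈ C, ConjClasses.mk g = c} := by
    rintro c ⟨hc, hgC⟩ c' ⟨hc', hgC'⟩ heq
    obtain ⟨p, hp⟩ := hmatch c hc hgC
    obtain ⟨p', hp'⟩ := hmatch c' hc' hgC'
    have hrc := hrep c hgC
    have hrc' := hrep c' hgC'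
    have hgood : ∀ v ∉ T, ∃ k ∈ UnitaryGroup.cmLocalIntegralLevel L 3 H₂ v,
        k * (UnitaryGroup.cmDatum L 3 H₂).toLocal v (rep c) * k⁻¹ = (UnitaryGroup.cmDatum L 3 H₂).toLocal v (rep c') := by
      intro v hv
      have h1 := p.corresponds_toLocal v
      rw [hp] at h1
      have h1' := p'.corresponds_toLocal v
      rw [hp'] at h1'
      exact hTP v hv _ _ (hS _ hrc.1 v (hTS v hv)) (hS _ hrc'.1 v (hTS v hv)) h1 h1'
    have hconj : IsConj (rep c) (rep c') := by
      refine UnitaryGroup.isConj_of_isConj_archPart_of_forall_exists_conj (↥(maximalRealSubfield L)) L (IsCMField.complexConj L) 3 H₂ ?_ (fun v => ?_) ?_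
      · exact ConjClasses.mk_eq_mk_iff_isConj.1 (congrArg Prod.snd heq)
      · by_cases hvT : v ∈ T
        · exact ConjClasses.mk_eq_mk_iff_isConj.1 (congrFun (congrArg Prod.fst heq) ⟨v, hvT⟩)
        · obtain ⟨k, -, hk⟩ := hgood v hvT
          exact isConj_iff.2 ⟨k, hk⟩
      · filter_upwards [T.finite_toSet.compl_mem_cofinite] with v hv
        obtain ⟨k, hk, hkeq⟩ := hgood v hv
        exact ⟨k, hk, hkeq⟩
    rw [← hrc.2, ← hrc'.2]
    exact ConjClasses.mk_eq_mk_iff_isConj.2 hconj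
  exact Set.Finite.of_finite_image (hfinTarget.subset hmaps.image_subset) hinj

/-! ## §3 `Σ_{δ ∈ 𝒞_𝐀(γ₀)} Φ(δ, f)` and its weighted twins are finite sums for every `f ∈ C_c(U(H₂)(𝐀))` and every family of orbital measures -/

/-- **The two-form adelic stable orbital sum over a regular `γ₀` is finitely supported** — EVERY family `m` of orbital measures on the classes of `U(H₂)(𝔸_L)`, EVERY `f`
with compact support: `(𝒞_𝐀(γ₀) ∩ support (c ↦ Φ_m(c, f))).Finite` (★ `orbitalIntegral_eq_zero_of_forall_notMem_tsupport` + §2); so ★ typ3's `adelicStableOrbitalSum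
(MatchingAdeleG₂.classes L H₁ H₂ γ₀) m f` is an honest finite sum. [cite: Rogawski1990, §4.3 p. 44; §5.4 p. 72] -/
theorem MatchingAdeleG₂.finite_classes_inter_support_classOrbitalIntegral (hH : (H₂.map (cmConjRingHom L))ᵀ = H₂) (hdet : H₂.det ≠ 0)
    (hreg : IsRegularElt (γ₀.val : GL (Fin 3) L))
    [∀ g : (UnitaryGroup.cmDatum L 3 H₂).Adelic,
      MeasurableSpace ((UnitaryGroup.cmDatum L 3 H₂).Adelic ⧸ Subgroup.centralizer ({g} : Set (UnitaryGroup.cmDatum L 3 H₂).Adelic))]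
    (m : OrbitalMeasureFamily (UnitaryGroup.cmDatum L 3 H₂).Adelic) {E : Type*} [NormedAddCommGroup E] [NormedSpace ℝ E]
    {f : (UnitaryGroup.cmDatum L 3 H₂).Adelic → E} (hf : HasCompactSupport f) :
    (MatchingAdeleG₂.classes L H₁ H₂ γ₀ ∩ Function.support (classOrbitalIntegral m f)).Finite := by
  refine (MatchingAdeleG₂.finite_setOf_mem_classes_inter hH hdet hreg hf.isCompact).subset ?_
  rintro c ⟨hc, hne⟩
  refine ⟨hc, ?_⟩
  by_contra hno
  refine hne ?_
  rw [classOrbitalIntegral_eq]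
  refine orbitalIntegral_eq_zero_of_forall_notMem_tsupport _ _ fun g hg => hno ⟨g * Quotient.out c * g⁻¹, hg, ?_⟩
  rw [← ConjClasses.mk_eq_mk_iff_isConj.2 (isConj_iff.2 ⟨g, rfl⟩), ← ConjClasses.quotient_mk_eq_mk, Quotient.out_eq]

/-- **… and so is every weighted (`κ`-twisted) summand** `c ↦ w c · Φ_m(c, f)` (the summands of ★ `adelicKappaOrbitalSum 𝒞_𝐀(γ₀) w m f`, (4.3.3) ∕ (5.4.2)).
[cite: Rogawski1990, §4.3 (4.3.3) p. 44; §5.4 (5.4.2) p. 72] -/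
theorem MatchingAdeleG₂.finite_classes_inter_support_mul_classOrbitalIntegral (hH : (H₂.map (cmConjRingHom L))ᵀ = H₂) (hdet : H₂.det ≠ 0)
    (hreg : IsRegularElt (γ₀.val : GL (Fin 3) L))
    [∀ g : (UnitaryGroup.cmDatum L 3 H₂).Adelic,
      MeasurableSpace ((UnitaryGroup.cmDatum L 3 H₂).Adelic ⧸ Subgroup.centralizer ({g} : Set (UnitaryGroup.cmDatum L 3 H₂).Adelic))]
    (m : OrbitalMeasureFamily (UnitaryGroup.cmDatum L 3 H₂).Adelic) (w : ConjClasses (UnitaryGroup.cmDatum L 3 H₂).Adelic → ℂ)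
    {f : (UnitaryGroup.cmDatum L 3 H₂).Adelic → ℂ} (hf : HasCompactSupport f) :
    (MatchingAdeleG₂.classes L H₁ H₂ γ₀ ∩ Function.support fun c => w c * classOrbitalIntegral m f c).Finite := by
  refine (MatchingAdeleG₂.finite_classes_inter_support_classOrbitalIntegral hH hdet hreg m hf).subset ?_
  rintro c ⟨hc, hne⟩
  refine ⟨hc, fun h0 => hne ?_⟩
  show w c * classOrbitalIntegral m f c = 0
  rw [h0, mul_zero]

/-- The same for `f ∈ C_c(U(H₂)(𝐀), E)`. [cite: Rogawski1990, §4.3 p. 44; §5.4 p. 72] -/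
theorem MatchingAdeleG₂.finite_classes_inter_support_classOrbitalIntegral_cc (hH : (H₂.map (cmConjRingHom L))ᵀ = H₂) (hdet : H₂.det ≠ 0)
    (hreg : IsRegularElt (γ₀.val : GL (Fin 3) L))
    [∀ g : (UnitaryGroup.cmDatum L 3 H₂).Adelic,
      MeasurableSpace ((UnitaryGroup.cmDatum L 3 H₂).Adelic ⧸ Subgroup.centralizer ({g} : Set (UnitaryGroup.cmDatum L 3 H₂).Adelic))]
    (m : OrbitalMeasureFamily (UnitaryGroup.cmDatum L 3 H₂).Adelic) {E : Type*} [NormedAddCommGroup E] [NormedSpace ℝ E]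
    (f : CompactlySupportedContinuousMap (UnitaryGroup.cmDatum L 3 H₂).Adelic E) :
    (MatchingAdeleG₂.classes L H₁ H₂ γ₀ ∩ Function.support (classOrbitalIntegral m f)).Finite :=
  MatchingAdeleG₂.finite_classes_inter_support_classOrbitalIntegral hH hdet hreg m f.hasCompactSupport

/-- **The adelic stable orbital sum over `𝒞_𝐀(γ₀)` is the honest finite sum** over the classes meeting the support. [cite: Rogawski1990, §5.4 (5.4.3) pp. 72–73] -/
theorem MatchingAdeleG₂.adelicStableOrbitalSum_classes_eq_sum (hH : (H₂.map (cmConjRingHom L))ᵀ = H₂) (hdet : H₂.det ≠ 0)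
    (hreg : IsRegularElt (γ₀.val : GL (Fin 3) L))
    [∀ g : (UnitaryGroup.cmDatum L 3 H₂).Adelic,
      MeasurableSpace ((UnitaryGroup.cmDatum L 3 H₂).Adelic ⧸ Subgroup.centralizer ({g} : Set (UnitaryGroup.cmDatum L 3 H₂).Adelic))]
    (m : OrbitalMeasureFamily (UnitaryGroup.cmDatum L 3 H₂).Adelic) {f : (UnitaryGroup.cmDatum L 3 H₂).Adelic → ℂ} (hf : HasCompactSupport f) :
    adelicStableOrbitalSum (MatchingAdeleG₂.classes L H₁ H₂ γ₀) m f =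
      ∑ c ∈ (MatchingAdeleG₂.finite_classes_inter_support_classOrbitalIntegral hH hdet hreg m hf).toFinset, classOrbitalIntegral m f c :=
  adelicStableOrbitalSum_eq_sum _ m f _

end FiniteG2

/-! ## §4 The SELF carrier `𝒞′_𝐀(γ₀) ⊂ ConjClasses U(H)(𝐀)` (`H₂ = H₁ = H`): the `hfin` of ★ `PreStabilisationCount` for every regular stable class, types (1)(2)(3) alike -/

section Self

variable {L : Type} [Field L] [NumberField L] [IsCMField L] {H : Matrix (Fin 3) (Fin 3) L} {γ₀ : (UnitaryGroup.cmDatum L 3 H).Rational}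
variable [∀ g : (UnitaryGroup.cmDatum L 3 H).Adelic,
  MeasurableSpace ((UnitaryGroup.cmDatum L 3 H).Adelic ⧸ Subgroup.centralizer ({g} : Set (UnitaryGroup.cmDatum L 3 H).Adelic))]

/-- **`hfin` for the pre-stabilisation, hypothesis-free**: over a REGULAR `γ₀ ∈ U(H)(L⁺)` (`H` non-degenerate hermitian — e.g. the anisotropic inner form of the T1 line),
for EVERY orbital family `m` on `U(H)(𝐀)` and EVERY compactly supported `f′`, `(𝒞′_𝐀(γ₀) ∩ support (Φ_m(·, f′))).Finite` — the `hfin` of ★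
`stableOrbitalSum_comp_eq_inv_card_mul_sum_adelicKappaOrbitalSum` at `𝒞 := MatchingAdeleG₂.classes L H H γ₀`, for stable classes of ALL three torus types.
[cite: Rogawski1990, §5.4 (5.4.1)–(5.4.3) pp. 72–73; §14.5 p. 238] -/
theorem MatchingAdeleG₂.finite_classes_inter_support_classOrbitalIntegral_self (hH : (H.map (cmConjRingHom L))ᵀ = H) (hdet : H.det ≠ 0)
    (hreg : IsRegularElt (γ₀.val : GL (Fin 3) L)) (m : OrbitalMeasureFamily (UnitaryGroup.cmDatum L 3 H).Adelic)
    {f : (UnitaryGroup.cmDatum L 3 H).Adelic → ℂ} (hf : HasCompactSupport f) :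
    (MatchingAdeleG₂.classes L H H γ₀ ∩ Function.support fun δ => classOrbitalIntegral m f δ).Finite :=
  MatchingAdeleG₂.finite_classes_inter_support_classOrbitalIntegral hH hdet hreg m hf

/-- The same for `f′ ∈ C_c(U(H)(𝐀))` (the T1 line's `TestGp L H`). [cite: Rogawski1990, §5.4 (5.4.1)–(5.4.3) pp. 72–73] -/
theorem MatchingAdeleG₂.finite_classes_inter_support_classOrbitalIntegral_self_cc (hH : (H.map (cmConjRingHom L))ᵀ = H) (hdet : H.det ≠ 0)
    (hreg : IsRegularElt (γ₀.val : GL (Fin 3) L)) (m : OrbitalMeasureFamily (UnitaryGroup.cmDatum L 3 H).Adelic)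
    (f : CompactlySupportedContinuousMap (UnitaryGroup.cmDatum L 3 H).Adelic ℂ) :
    (MatchingAdeleG₂.classes L H H γ₀ ∩ Function.support fun δ => classOrbitalIntegral m f δ).Finite :=
  MatchingAdeleG₂.finite_classes_inter_support_classOrbitalIntegral hH hdet hreg m f.hasCompactSupport

omit [∀ g : (UnitaryGroup.cmDatum L 3 H).Adelic,
  MeasurableSpace ((UnitaryGroup.cmDatum L 3 H).Adelic ⧸ Subgroup.centralizer ({g} : Set (UnitaryGroup.cmDatum L 3 H).Adelic))] in
/-- **`𝒞′_𝐀(γ₀)` meets every compact set of `U(H)(𝐀)` in finitely many classes** (self carrier). [cite: Rogawski1990, §3.3 p. 21; §5.4 p. 72] -/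
theorem MatchingAdeleG₂.finite_meeting_isCompact_self (hH : (H.map (cmConjRingHom L))ᵀ = H) (hdet : H.det ≠ 0) (hreg : IsRegularElt (γ₀.val : GL (Fin 3) L))
    {C : Set (UnitaryGroup.cmDatum L 3 H).Adelic} (hC : IsCompact C) :
    {c : ConjClasses (UnitaryGroup.cmDatum L 3 H).Adelic | c ∈ MatchingAdeleG₂.classes L H H γ₀ ∧ ∃ g ∈ C, ConjClasses.mk g = c}.Finite :=
  MatchingAdeleG₂.finite_setOf_mem_classes_inter hH hdet hreg hC

end Self

end Literature.NumberTheory.Rogawski1990
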